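import Literature.Geometry.Manifold.DeRhamMap
import Literature.Algebra.Homology.HomologyOfGluing
import Mathlib.Analysis.Convex.PathConnected
import HarnessLib

/-!
# The de Rham homomorphism and the smooth-chain restriction on disjoint unions

Property (3) of Bredon's bootstrap (*Topology and Geometry* (1993), §V.9, proof of Thm. V.9.5)
for the two comparison maps of the integration proof of de Rham's theorem: if `U = ⋃ᵢ Uᵢ` is a
union of pairwise disjoint open sets and the de Rham homomorphism `Ψ_{Uᵢ}` (resp. the
restriction `toSmooth Uᵢ` from all to smooth singular cochains) is an isomorphism on cohomology
for every `i`, then so is `Ψ_U` (resp. `toSmooth U`):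
`isIso_homologyMap_deRhamMap_iUnion`, `isIso_homologyMap_toSmooth_iUnion`.

The reason is that all three complexes turn disjoint unions into products: a form on `U`
vanishing off `U` is the same as a family of such forms on the `Uᵢ` (`forms_jointly_bijective`),
and, a singular simplex being connected, a (smooth) simplex in `U` lies in exactly one `Uᵢ`, so
that cochains on (smooth) chains in `U` are families of cochains on the `Uᵢ`
(`dual_jointly_bijective`); the abstract gluing statement is
`Literature.Algebra.Homology.isIso_homologyMap_of_jointly_bijective`.

## References

* G. E. Bredon, *Topology and Geometry*, GTM 139 (1993), §V.9, Thm. V.9.5.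
-/

noncomputable section

-- see "Implementation notes" in `…SingularHomology.SingularChainsConcrete`
set_option backward.isDefEq.respectTransparency false

open scoped Manifold ContDiff Topology
open CategoryTheory Limits Set Literature.AlgebraicTopology.SingularHomology Literature.Geometry.Kaehler

universe u v s

namespace Literature.Geometry.Manifold

variable {E : Type u} [NormedAddCommGroup E] [NormedSpace ℝ E]
  {H : Type u} [TopologicalSpace H] (I : ModelWithCorners ℝ E H)
  {M : Type u} [TopologicalSpace M] [ChartedSpace H M]
  {ι : Type s} {U : ι → Set M}

/-! ### A simplex in a disjoint union of open sets lies in one of them -/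

section Simplex

omit [ChartedSpace H M]

/-- The image of a singular simplex is preconnected. [folklore] -/
theorem _root_.Literature.AlgebraicTopology.SingularHomology.SingularSimplex.isPreconnected_range
    {n : ℕ} (σ : SingularSimplex M n) : IsPreconnected σ.range := by
  haveI : PreconnectedSpace (StdSimplex n) :=
    Subtype.preconnectedSpace (convex_stdSimplex ℝ (Fin (n + 1))).isPreconnected
  exact _root_.isPreconnected_range
    (Literature.AlgebraicTopology.SingularHomology.SingularSimplex.toContinuousMap σ).continuous

/-- **A singular simplex with image in a union of pairwise disjoint open sets has image in one of
them** (its image is connected). [folklore] -/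
theorem _root_.Literature.AlgebraicTopology.SingularHomology.SingularSimplex.exists_range_subset
    (hUo : ∀ i, IsOpen (U i)) (hd : Pairwise (Function.onFun Disjoint U)) {n : ℕ}
    (σ : SingularSimplex M n) (h : σ.range ⊆ ⋃ i, U i) : ∃ i, σ.range ⊆ U i := by
  obtain ⟨x₀, hx₀⟩ := σ.range_nonempty
  obtain ⟨i₀, hi₀⟩ := mem_iUnion.1 (h hx₀)
  refine ⟨i₀, ?_⟩
  have hcov : σ.range ⊆ U i₀ ∪ ⋃ (i) (_ : i ≠ i₀), U i := fun x hx ↦ by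
    obtain ⟨i, hi⟩ := mem_iUnion.1 (h hx)
    by_cases hii : i = i₀
    · exact Or.inl (hii ▸ hi)
    · exact Or.inr (mem_iUnion₂.2 ⟨i, hii, hi⟩)
  have hempty : σ.range ∩ (U i₀ ∩ ⋃ (i) (_ : i ≠ i₀), U i) = ∅ := by
    refine eq_empty_of_forall_notMem fun x ⟨_, hx₁, hx₂⟩ ↦ ?_
    obtain ⟨i, hi, hx⟩ := mem_iUnion₂.1 hx₂
    exact (hd hi).le_bot ⟨hx, hx₁⟩
  rcases (isPreconnected_iff_subset_of_disjoint.1 σ.isPreconnected_range) (U i₀) (⋃ (i) (_ : i ≠ i₀), U i)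
      (hUo i₀) (isOpen_biUnion fun i _ ↦ hUo i) hcov hempty with h' | h'
  · exact h'
  · exfalso
    obtain ⟨i, hi, hx⟩ := mem_iUnion₂.1 (h' hx₀)
    exact (hd hi).le_bot ⟨hx, hi₀⟩

/-- The piece containing a simplex is unique. [folklore] -/
theorem _root_.Literature.AlgebraicTopology.SingularHomology.SingularSimplex.eq_of_range_subset
    (hd : Pairwise (Function.onFun Disjoint U)) {n : ℕ} (σ : SingularSimplex M n) {i j : ι}
    (hi : σ.range ⊆ U i) (hj : σ.range ⊆ U j) : i = j := by
  by_contra hij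
  obtain ⟨x₀, hx₀⟩ := σ.range_nonempty
  exact (hd hij).le_bot ⟨hi hx₀, hj hx₀⟩

end Simplex

/-! ### Cochains on (smooth) chains in a disjoint union -/

section Dual

omit [ChartedSpace H M]

variable {R : Type v} [CommRing R] (N : ModuleCat.{max u v} R)

/-- The support of an elementary chain. [folklore] -/
theorem eq_of_mem_support_single {n : ℕ} {σ τ : SingularSimplex M n} {r : R}
    (h : τ ∈ (Finsupp.single σ r).support) : τ = σ :=
  Finset.mem_singleton.1 (Finsupp.support_single_subset h)

/-- An element of a degree of a subcomplex of singular chains whose membership is a condition on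
simplices is the sum of its elementary pieces, inside the subcomplex. [folklore] -/
theorem subcomplex_eq_sum_single {n : ℕ} (S : Subcomplex (csingularChainComplex R R M))
    (hS : ∀ x : CChain R M n, x ∈ S n → ∀ σ ∈ x.support, Finsupp.single σ (x σ) ∈ S n)
    (c : CChain R M n) (hc : c ∈ S n) :
    (⟨c, hc⟩ : ↥(S n)) = ∑ τ ∈ c.support.attach, (⟨Finsupp.single τ.1 (c τ.1), hS c hc τ.1 τ.2⟩ : ↥(S n)) := by
  apply Subtype.ext
  rw [Submodule.coe_sum]
  change c = _
  conv_lhs => rw [← Finsupp.sum_single c, Finsupp.sum]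
  exact (Finset.sum_attach _ _).symm

/-- Scaling an elementary chain inside a subcomplex. [folklore] -/
theorem subcomplex_single_eq_smul {n : ℕ} (S : Subcomplex (csingularChainComplex R R M))
    {σ : SingularSimplex M n} (r : R) (h1 : Finsupp.single σ (1 : R) ∈ S n) (hr : Finsupp.single σ r ∈ S n) :
    (⟨Finsupp.single σ r, hr⟩ : ↥(S n)) = r • ⟨Finsupp.single σ 1, h1⟩ := by
  apply Subtype.ext
  change (Finsupp.single σ r : CChain R M n) = r • Finsupp.single σ 1
  rw [Finsupp.smul_single_one]

/-- **Cochains on (smooth) chains in a disjoint union of open sets are families of cochains on the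
pieces**: the joint restriction is bijective. Here `T` and `Tᵢ` are the subcomplexes of chains
all of whose simplices satisfy a predicate `Q` and lie in `⋃ Uᵢ`, resp. in `Uᵢ`.
[cite: Bredon1993, §V.9] -/
theorem dual_jointly_bijective (hUo : ∀ i, IsOpen (U i)) (hd : Pairwise (Function.onFun Disjoint U))
    (Q : ∀ n, SingularSimplex M n → Prop)
    (T : Subcomplex (csingularChainComplex R R M)) (Ti : ι → Subcomplex (csingularChainComplex R R M))
    (hle : ∀ i, Ti i ≤ T)
    (hT : ∀ n (x : CChain R M n), x ∈ T n ↔ ∀ σ ∈ x.support, Q n σ ∧ σ.range ⊆ ⋃ i, U i)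
    (hTi : ∀ i n (x : CChain R M n), x ∈ Ti i n ↔ ∀ σ ∈ x.support, Q n σ ∧ σ.range ⊆ U i) (n : ℕ) :
    Function.Bijective fun (ψ : (dualObj R N T.toComplex).X n) (i : ι) ↦
      (dualMap R N (Subcomplex.incl (hle i))).f n ψ := by
  classical
  have hsingleT : ∀ {σ : SingularSimplex M n} (r : R), Q n σ → σ.range ⊆ (⋃ i, U i) →
      Finsupp.single σ r ∈ T n := fun r hq hr ↦
    (hT n _).2 fun τ hτ ↦ by rw [eq_of_mem_support_single hτ]; exact ⟨hq, hr⟩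
  have hsingleTi : ∀ {σ : SingularSimplex M n} (i : ι) (r : R), Q n σ → σ.range ⊆ U i →
      Finsupp.single σ r ∈ Ti i n := fun i r hq hr ↦
    (hTi i n _).2 fun τ hτ ↦ by rw [eq_of_mem_support_single hτ]; exact ⟨hq, hr⟩
  have hST : ∀ x : CChain R M n, x ∈ T n → ∀ σ ∈ x.support, Finsupp.single σ (x σ) ∈ T n :=
    fun x hx σ hσ ↦ hsingleT _ ((hT n x).1 hx σ hσ).1 ((hT n x).1 hx σ hσ).2
  have hSTi : ∀ i (x : CChain R M n), x ∈ Ti i n → ∀ σ ∈ x.support, Finsupp.single σ (x σ) ∈ Ti i n :=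
    fun i x hx σ hσ ↦ hsingleTi i _ ((hTi i n x).1 hx σ hσ).1 ((hTi i n x).1 hx σ hσ).2
  constructor
  · -- injective: a cochain is determined by its values on elementary chains, each in some `Tᵢ`
    intro ψ₁ ψ₂ h
    refine ModuleCat.hom_ext (LinearMap.ext fun x ↦ ?_)
    obtain ⟨c, hc⟩ := x
    change CChain R M n at c
    rw [subcomplex_eq_sum_single T hST c hc, map_sum, map_sum]
    refine Finset.sum_congr rfl fun τ _ ↦ ?_
    obtain ⟨hq, hr⟩ := (hT n c).1 hc τ.1 τ.2
    obtain ⟨i, hri⟩ := SingularSimplex.exists_range_subset hUo hd τ.1 hr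
    have hmem : Finsupp.single τ.1 (c τ.1) ∈ Ti i n := hsingleTi i _ hq hri
    have key := congrFun h i
    simp only [dualMap_f_apply] at key
    have key' := congrArg (fun χ : (Ti i).toComplex.X n ⟶ N ↦ ModuleCat.Hom.hom χ ⟨_, hmem⟩) key
    simp only [ModuleCat.hom_comp, LinearMap.comp_apply] at key'
    exact key'
  · -- surjective: glue
    intro ψs
    -- value on a simplex: that of the cochain of the piece containing it
    let val : SingularSimplex M n → N := fun σ ↦
      if h : Q n σ ∧ ∃ i, σ.range ⊆ U i then
        ModuleCat.Hom.hom (ψs h.2.choose) ⟨Finsupp.single σ 1, hsingleTi _ 1 h.1 h.2.choose_spec⟩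
      else 0
    let Tot : CChain R M n →ₗ[R] N := Finsupp.lsum R fun σ ↦ LinearMap.toSpanSingleton R N (val σ)
    have hTot : ∀ (σ : SingularSimplex M n) (r : R), Tot (Finsupp.single σ r) = r • val σ := fun σ r ↦ by
      simp only [Tot, Finsupp.lsum_single, LinearMap.toSpanSingleton_apply]
    have hval : ∀ {σ : SingularSimplex M n} {i : ι} (hq : Q n σ) (hri : σ.range ⊆ U i),
        val σ = ModuleCat.Hom.hom (ψs i) ⟨Finsupp.single σ 1, hsingleTi i 1 hq hri⟩ := by
      intro σ i hq hri
      have h : Q n σ ∧ ∃ i, σ.range ⊆ U i := ⟨hq, i, hri⟩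
      simp only [val, dif_pos h]
      have hgen : ∀ (j : ι) (hj : σ.range ⊆ U j) (p : Finsupp.single σ (1 : R) ∈ Ti j n),
          ModuleCat.Hom.hom (ψs j) ⟨Finsupp.single σ 1, p⟩ =
            ModuleCat.Hom.hom (ψs i) ⟨Finsupp.single σ 1, hsingleTi i 1 hq hri⟩ := by
        intro j hj p
        obtain rfl := σ.eq_of_range_subset hd hj hri
        rfl
      exact hgen _ h.2.choose_spec _
    let ψ : T.toComplex.X n ⟶ N := ModuleCat.ofHom (Tot ∘ₗ (T n).subtype)
    refine ⟨ψ, funext fun i ↦ ?_⟩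
    change (dualMap R N (Subcomplex.incl (hle i))).f n ψ = ψs i
    rw [dualMap_f_apply]
    refine ModuleCat.hom_ext (LinearMap.ext fun x ↦ ?_)
    obtain ⟨c, hc⟩ := x
    change CChain R M n at c
    rw [subcomplex_eq_sum_single (Ti i) (hSTi i) c hc, map_sum, map_sum]
    refine Finset.sum_congr rfl fun τ _ ↦ ?_
    obtain ⟨hq, hri⟩ := (hTi i n c).1 hc τ.1 τ.2
    rw [subcomplex_single_eq_smul (Ti i) (c τ.1) (hsingleTi i 1 hq hri), map_smul, map_smul,
      ← hval hq hri]
    congr 1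
    change Tot (Finsupp.single τ.1 (1 : R)) = val τ.1
    rw [hTot, one_smul]

end Dual

/-! ### Forms on a disjoint union -/

section Forms

variable [IsManifold I ∞ M] {F : Type} [NormedAddCommGroup F] [NormedSpace ℝ F]

/-- **Forms on a disjoint union of open sets (vanishing outside) are families of forms on the
pieces**: the joint restriction is bijective. [cite: Bredon1993, §V.9] -/
theorem forms_jointly_bijective (hUo : ∀ i, IsOpen (U i)) (hd : Pairwise (Function.onFun Disjoint U))
    (k : ℕ) :
    Function.Bijective fun (η : (localDeRhamComplex I F (isOpen_iUnion hUo)).X k) (i : ι) ↦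
      (localDeRhamComplex.res I F (hUo i) (isOpen_iUnion hUo) (subset_iUnion U i)).f k η := by
  classical
  have huniq : ∀ {x : M} {i j : ι}, x ∈ U i → x ∈ U j → i = j := fun hi hj ↦ by
    by_contra hij; exact (hd hij).le_bot ⟨hi, hj⟩
  constructor
  · intro η₁ η₂ h
    apply Subtype.ext
    funext x
    by_cases hx : x ∈ ⋃ i, U i
    · obtain ⟨i, hi⟩ := mem_iUnion.1 hx
      have key := congrArg (fun (ζ : (localDeRhamComplex I F (hUo i)).X k) ↦ (ζ.1 : MForm I M F k) x)
        (congrFun h i)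
      simp only [localDeRhamComplex.res_f_apply, coe_restrictₗ, MForm.restr_apply_of_mem _ hi] at key
      exact key
    · rw [η₁.2.2 x hx, η₂.2.2 x hx]
  · intro ηs
    let η : MForm I M F k := fun x ↦ if h : ∃ i, x ∈ U i then ((ηs h.choose).1 : MForm I M F k) x else 0
    have hηU : ∀ {i : ι} {x : M}, x ∈ U i → η x = ((ηs i).1 : MForm I M F k) x := by
      intro i x hx
      have h : ∃ i, x ∈ U i := ⟨i, hx⟩
      simp only [η, dif_pos h]
      have hgen : ∀ (j : ι), x ∈ U j → ((ηs j).1 : MForm I M F k) x = ((ηs i).1 : MForm I M F k) x := by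
        intro j hj
        obtain rfl := huniq hj hx
        rfl
      exact hgen _ h.choose_spec
    have hmem : η ∈ smoothFormsOn I F (⋃ i, U i) k := by
      refine ⟨fun x hx ↦ ?_, fun x hx ↦ ?_⟩
      · obtain ⟨i, hi⟩ := mem_iUnion.1 hx
        have hev : ∀ᶠ y in 𝓝 x, η y = ((ηs i).1 : MForm I M F k) y := by
          filter_upwards [(hUo i).mem_nhds hi] with y hy
          exact hηU hy
        exact (MForm.smoothAt_congr_of_eventuallyEq hev).2 ((ηs i).2.1 x hi)
      · have h : ¬∃ i, x ∈ U i := fun ⟨i, hi⟩ ↦ hx (mem_iUnion.2 ⟨i, hi⟩)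
        simp only [η, dif_neg h]
    refine ⟨⟨η, hmem⟩, funext fun i ↦ Subtype.ext (funext fun x ↦ ?_)⟩
    simp only [localDeRhamComplex.res_f_apply, coe_restrictₗ]
    by_cases hx : x ∈ U i
    · rw [MForm.restr_apply_of_mem _ hx]
      exact hηU hx
    · rw [MForm.restr_apply_of_notMem _ hx, ((ηs i).2.2 x hx)]

end Forms

/-! ### The two comparison maps on disjoint unions -/

section Conclusions

/-- Smooth chains in a set: membership as a condition on simplices. [folklore] -/
theorem mem_smoothChainsInSub_iff_forall {R : Type v} [CommRing R] {V : Set M} {n : ℕ} (x : CChain R M n) :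
    x ∈ smoothChainsInSub I R R M V n ↔ ∀ σ ∈ x.support, σ.IsSmooth I ∧ σ.range ⊆ V := by
  change x ∈ smoothChains I R R M n ⊓ chainsIn R R M V n ↔ _
  rw [Submodule.mem_inf, mem_smoothChains_iff, mem_chainsIn_iff]
  exact ⟨fun h σ hσ ↦ ⟨h.1 σ hσ, h.2 σ hσ⟩, fun h ↦ ⟨fun σ hσ ↦ (h σ hσ).1, fun σ hσ ↦ (h σ hσ).2⟩⟩

omit [ChartedSpace H M] in
/-- Chains in a set: membership as a condition on simplices (with a trivial predicate). [folklore] -/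
theorem mem_chainsInSub_iff' {R : Type v} [CommRing R] {V : Set M} {n : ℕ} (x : CChain R M n) :
    x ∈ chainsInSub R R M V n ↔ ∀ σ ∈ x.support, True ∧ σ.range ⊆ V := by
  rw [show (x ∈ chainsInSub R R M V n) = (x ∈ chainsIn R R M V n) from rfl, mem_chainsIn_iff]
  simp only [true_and]

variable [IsManifold I ∞ M]

/-- **The de Rham homomorphism of a disjoint union** is an isomorphism on cohomology as soon as
those of the pieces are (Bredon (1993), proof of Thm. V.9.5, property (3)). [cite: Bredon1993, Thm. V.9.5] -/
theorem isIso_homologyMap_deRhamMap_iUnion (hUo : ∀ i, IsOpen (U i)) (hd : Pairwise (Function.onFun Disjoint U))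
    (h : ∀ i q, IsIso (HomologicalComplex.homologyMap (deRhamMap I (hUo i)) q)) (q : ℕ) :
    IsIso (HomologicalComplex.homologyMap (deRhamMap I (isOpen_iUnion hUo)) q) :=
  Literature.Algebra.Homology.isIso_homologyMap_of_jointly_bijective (deRhamMap I (isOpen_iUnion hUo))
    (fun i ↦ deRhamMap I (hUo i))
    (fun i ↦ localDeRhamComplex.res I ℝ (hUo i) (isOpen_iUnion hUo) (subset_iUnion U i))
    (fun i ↦ smoothSubsetCochains.res I ℝ realCoeff (subset_iUnion U i))
    (fun i ↦ deRhamMap_naturality_res (hUo i) (isOpen_iUnion hUo) (subset_iUnion U i))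
    (forms_jointly_bijective I hUo hd)
    (dual_jointly_bijective realCoeff hUo hd (fun _ σ ↦ σ.IsSmooth I) (smoothChainsInSub I ℝ ℝ M (⋃ i, U i))
      (fun i ↦ smoothChainsInSub I ℝ ℝ M (U i)) (fun i ↦ smoothChainsInSub_mono (subset_iUnion U i))
      (fun _ x ↦ mem_smoothChainsInSub_iff_forall I x) (fun _ _ x ↦ mem_smoothChainsInSub_iff_forall I x))
    q fun i ↦ h i q

omit [IsManifold I ∞ M] in
/-- **The restriction to smooth chains on a disjoint union** is an isomorphism on cohomology as
soon as those of the pieces are (Bredon (1993), proof of Thm. V.9.5, property (3)). [cite: Bredon1993, Thm. V.9.5] -/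
theorem isIso_homologyMap_toSmooth_iUnion {R : Type v} [CommRing R] (N : ModuleCat.{max u v} R)
    (hUo : ∀ i, IsOpen (U i)) (hd : Pairwise (Function.onFun Disjoint U))
    (h : ∀ i q, IsIso (HomologicalComplex.homologyMap (smoothSubsetCochains.toSmooth I R N (U i)) q)) (q : ℕ) :
    IsIso (HomologicalComplex.homologyMap (smoothSubsetCochains.toSmooth I R N (⋃ i, U i)) q) :=
  Literature.Algebra.Homology.isIso_homologyMap_of_jointly_bijective (smoothSubsetCochains.toSmooth I R N (⋃ i, U i))
    (fun i ↦ smoothSubsetCochains.toSmooth I R N (U i))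
    (fun i ↦ subsetCochains.res R N (subset_iUnion U i))
    (fun i ↦ smoothSubsetCochains.res I R N (subset_iUnion U i))
    (fun i ↦ smoothSubsetCochains.res_comp_toSmooth I R N (subset_iUnion U i))
    (dual_jointly_bijective N hUo hd (fun _ _ ↦ True) (chainsInSub R R M (⋃ i, U i))
      (fun i ↦ chainsInSub R R M (U i)) (fun i ↦ chainsInSub_mono R R (subset_iUnion U i))
      (fun _ x ↦ mem_chainsInSub_iff' x) (fun _ _ x ↦ mem_chainsInSub_iff' x))
    (dual_jointly_bijective N hUo hd (fun _ σ ↦ σ.IsSmooth I) (smoothChainsInSub I R R M (⋃ i, U i))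
      (fun i ↦ smoothChainsInSub I R R M (U i)) (fun i ↦ smoothChainsInSub_mono (subset_iUnion U i))
      (fun _ x ↦ mem_smoothChainsInSub_iff_forall I x) (fun _ _ x ↦ mem_smoothChainsInSub_iff_forall I x))
    q fun i ↦ h i q

end Conclusions

end Literature.Geometry.Manifold
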